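import Summits.AtomisticToContinuum.FouriersLaw.Theses.EmbeddedDrudeMourre
import Literature.MathematicalPhysics.KineticTheory.InfiniteChainSuperstableDynamics
import Literature.MathematicalPhysics.KineticTheory.InfiniteChainGibbsInvariance
import Literature.MathematicalPhysics.KineticTheory.InfiniteChainGoodSetSymmetries
import Literature.MathematicalPhysics.KineticTheory.ChainReflection

/-!
# `EmbeddedDrudeMourre.MourreDissolution`, line `separable-vertex-faddeev-pair-sector` —
# helpers for stub `stub_symmetricFramework`, part 1/3: reflection symmetry of the infinite chain

Item `stmt-AtomisticToContinuum-12594` (crux `MourreDissolution` of route `EmbeddedDrudeMourre`,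
sub-problem `FouriersLaw`), registered stub `stub_symmetricFramework` (S1) of the line skeleton
`Cruxes/MourreDissolution/Lines/separable_vertex_faddeev_pair_sector.lean`.

The registered statement asks, for `P = pinnedChain ω₂ lam β γ` (all parameters `> 0`): ONE
infinite-volume dynamics `D` with `D.carrier = bmGood P` and, for every `T > 0`, a zero-wavenumber
datum `ZeroWavenumberData P D` whose state is a DLR Gibbs state at `T` with the superstability
estimate, momentum-reversal symmetric, spatial-reflection symmetric (`ι σ = σ(−·)`: state,
observables, flow), with strongly continuous Koopman group. The three helper files reduce this,
sorry-free, to ONE scalar hypothesis (H) (existence of a shift-invariant, superstable, `ι`-invariant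
DLR state with two clustering/continuity properties of the canonical flow; part 3/3,
`symmetricFramework_of_clustering`). This first part proves:

* §1 the spatial reflection `ι` of the infinite chain: measurability, `ι ∘ τ_x = τ_{-x} ∘ ι`,
  `ι ∘ R = R ∘ ι`, `W_{m,k}(ι σ) = W_{-m,k}(σ)`, hence **`bmGood` and Buttà–Marchioro's `Q` are
  `ι`-invariant**; `F_i(ι σ) = F_{-i}(σ)` for even `V`, so solutions reflect to solutions and **the
  flow commutes with `ι`** on a `ι`-invariant carrier (uniqueness of solutions);
* §2 `exists_symmetric_bmDynamics` (the registered helper stub of this file, stated with all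
  binders explicit and fully qualified names): the canonical Buttà–Marchioro dynamics of
  `pinnedChain` (`OscillatorChain.exists_bmDynamics`: carrier `bmGood`, measurable flow, identity
  off `bmGood`, group law, preservation of every superstable Gibbs state) commutes EXACTLY with
  `τ_x`, with `R` up to time reversal, and with `ι`.

All statements about `ι` are written in the `β`-reduced form `fun y => σ (-y)` of `ι σ` (the
registered stub spells `ι` as the literal `fun σ x => σ (-x)`).
-/

noncomputable section

namespace Summit.AtomisticToContinuum.FouriersLaw.Theorems.MourreDissolution

open Filter Topology MeasureTheory ProbabilityTheory Set Function
open Literature.MathematicalPhysics.KineticTheory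
open Literature.MathematicalPhysics.KineticTheory.HeatConduction

/-! ## §1. The spatial reflection `ι σ = σ(−·)` of the infinite chain -/

/-- `ι` is measurable. [folklore] -/
theorem measurable_reflect : Measurable fun (σ : ℤ → ℝ × ℝ) (x : ℤ) => σ (-x) :=
  measurable_pi_lambda _ fun x => measurable_pi_apply (-x)

/-- `ι` is an involution. [folklore] -/
theorem reflect_reflect (σ : ChainConfig) : (fun y : ℤ => (fun x : ℤ => σ (-x)) (-y)) = σ := by
  funext x
  simp

/-- `ι ∘ ι = id`. [folklore] -/
theorem reflect_comp_reflect :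
    ((fun (σ : ℤ → ℝ × ℝ) (x : ℤ) => σ (-x)) ∘ fun (σ : ℤ → ℝ × ℝ) (x : ℤ) => σ (-x)) = id := by
  funext σ x
  simp

/-- `ι ∘ τ_x = τ_{-x} ∘ ι`. [folklore] -/
theorem reflect_comp_chainShift (x : ℤ) :
    ((fun (σ : ℤ → ℝ × ℝ) (y : ℤ) => σ (-y)) ∘ chainShift x) =
      chainShift (-x) ∘ fun (σ : ℤ → ℝ × ℝ) (y : ℤ) => σ (-y) := by
  funext σ i
  simp only [comp_apply, chainShift_apply]
  congr 1
  ring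

/-- `ι` commutes with the momentum reversal (definitionally). [folklore] -/
theorem reflect_comp_chainReversal :
    ((fun (σ : ℤ → ℝ × ℝ) (y : ℤ) => σ (-y)) ∘ chainReversal) =
      chainReversal ∘ fun (σ : ℤ → ℝ × ℝ) (y : ℤ) => σ (-y) := rfl

/-- **Reflection covariance of Buttà–Marchioro's local energies**: `W_{m,k}(ι σ) = W_{-m,k}(σ)`
(the box `Λ_{m,k}` is reflected onto `Λ_{-m,k}`; the ordered pair sum of (2.4) is symmetric, so no
evenness of `V` is needed). [folklore] -/
theorem bmLocalEnergy_reflect (P : OscillatorChain) (m : ℤ) (k : ℕ) (σ : ChainConfig) :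
    P.bmLocalEnergy m k (fun y : ℤ => σ (-y)) = P.bmLocalEnergy (-m) k σ := by
  have hmem : ∀ i : ℤ, i ∈ Finset.Icc (m - k) (m + k) ↔
      (Equiv.neg ℤ) i ∈ Finset.Icc (-m - k) (-m + k) := fun i => by
    simp only [Finset.mem_Icc, Equiv.neg_apply]
    omega
  unfold OscillatorChain.bmLocalEnergy
  congr 1
  · exact Finset.sum_equiv (Equiv.neg ℤ) hmem fun i _ => by simp
  · refine Finset.sum_equiv (Equiv.neg ℤ) hmem fun i _ => ?_
    refine Finset.sum_equiv (Equiv.neg ℤ) hmem fun j _ => ?_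
    simp only [Equiv.neg_apply]
    have : |(-j) - (-i)| = |j - i| := by rw [← abs_neg]; ring_nf
    rw [this]

/-- The set of normalised local energies entering BM's `Q` is reflection invariant (the
admissibility condition `k > log(e + |m|)` is even in `m`). [folklore] -/
theorem bmGrowthSet_reflect (P : OscillatorChain) (σ : ChainConfig) :
    P.bmGrowthSet (fun y : ℤ => σ (-y)) = P.bmGrowthSet σ := by
  ext r
  simp only [OscillatorChain.bmGrowthSet, mem_setOf_eq, bmLocalEnergy_reflect]
  constructor
  · rintro ⟨m, k, hk, rfl⟩
    exact ⟨-m, k, by simpa using hk, rfl⟩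
  · rintro ⟨m, k, hk, rfl⟩
    exact ⟨-m, k, by simpa using hk, by rw [neg_neg]⟩

/-- `Q(ι σ) = Q(σ)`. [folklore] -/
theorem bmGrowth_reflect (P : OscillatorChain) (σ : ChainConfig) :
    P.bmGrowth (fun y : ℤ => σ (-y)) = P.bmGrowth σ := by
  simp only [OscillatorChain.bmGrowth, bmGrowthSet_reflect]

/-- **BM's good set `𝒳₀` is reflection invariant.** [folklore] -/
theorem reflect_mem_bmGood_iff (P : OscillatorChain) (σ : ChainConfig) :
    (fun y : ℤ => σ (-y)) ∈ P.bmGood ↔ σ ∈ P.bmGood := by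
  simp only [OscillatorChain.bmGood, mem_setOf_eq, bmGrowthSet_reflect]

/-- `ι` maps `𝒳₀` into itself. [folklore] -/
theorem mapsTo_reflect_bmGood (P : OscillatorChain) :
    MapsTo (fun (σ : ℤ → ℝ × ℝ) (y : ℤ) => σ (-y)) P.bmGood P.bmGood := fun σ hσ =>
  (reflect_mem_bmGood_iff P σ).2 hσ

/-- **The forces are reflection covariant for an even interaction**: `F_i(ι σ) = F_{-i}(σ)`
(`V'` is odd). [folklore] -/
theorem force_reflect (P : OscillatorChain) (hV : ∀ r, P.V (-r) = P.V r) (σ : ChainConfig) (i : ℤ) :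
    P.force (fun y : ℤ => σ (-y)) i = P.force σ (-i) := by
  simp only [OscillatorChain.force, OscillatorChain.interactionForce]
  have e1 : (-(i + 1) : ℤ) = -i - 1 := by ring
  have e2 : (-(i - 1) : ℤ) = -i + 1 := by ring
  rw [e1, e2]
  have h1 : deriv P.V ((σ (-i - 1)).1 - (σ (-i)).1) = -deriv P.V ((σ (-i)).1 - (σ (-i - 1)).1) := by
    rw [← neg_sub, P.deriv_V_neg hV]
  have h2 : deriv P.V ((σ (-i)).1 - (σ (-i + 1)).1) = -deriv P.V ((σ (-i + 1)).1 - (σ (-i)).1) := by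
    rw [← neg_sub, P.deriv_V_neg hV]
  rw [h1, h2]
  ring

/-- **The equations of motion are reflection covariant** (even `V`): if `γ` solves (1a)–(1b) then
so does `t ↦ ι γ(t)`. [folklore] -/
theorem isSolution_reflect {P : OscillatorChain} (hV : ∀ r, P.V (-r) = P.V r) {γ : ℝ → ChainConfig}
    (hγ : P.IsSolution γ) : P.IsSolution fun (t : ℝ) (y : ℤ) => γ t (-y) := by
  intro i t
  obtain ⟨h1, h2⟩ := hγ (-i) t
  refine ⟨h1, ?_⟩
  rw [force_reflect P hV]
  exact h2

/-- **The flow commutes with the reflection** on a reflection-invariant carrier, for even `V`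
(uniqueness of solutions within the carrier + reflection covariance of the equations):
`φ_t (ι σ) = ι (φ_t σ)`. [folklore] -/
theorem flow_reflect {P : OscillatorChain} (D : InfiniteChainDynamics P) (hV : ∀ r, P.V (-r) = P.V r)
    (hcar : MapsTo (fun (σ : ℤ → ℝ × ℝ) (y : ℤ) => σ (-y)) D.carrier D.carrier)
    {σ : ChainConfig} (hσ : σ ∈ D.carrier) (t : ℝ) :
    D.flow t (fun y : ℤ => σ (-y)) = fun y : ℤ => D.flow t σ (-y) := by
  have h := D.unique (fun (s : ℝ) (y : ℤ) => D.flow s σ (-y))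
    (fun s => hcar (D.flow_mem hσ s)) (isSolution_reflect hV (D.isSolution σ hσ)) t
  simp only [D.flow_zero σ hσ] at h
  exact h.symm

/-- A.e. form: if `μ` is carried by a reflection-invariant carrier then `ι ∘ φ_t = φ_t ∘ ι`
`μ`-a.e. [folklore] -/
theorem reflect_comp_flow_ae {P : OscillatorChain} (D : InfiniteChainDynamics P)
    (hV : ∀ r, P.V (-r) = P.V r)
    (hcar : MapsTo (fun (σ : ℤ → ℝ × ℝ) (y : ℤ) => σ (-y)) D.carrier D.carrier)
    {μ : Measure ChainConfig} (hμ : ∀ᵐ σ ∂μ, σ ∈ D.carrier) (t : ℝ) :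
    (fun (σ : ℤ → ℝ × ℝ) (y : ℤ) => σ (-y)) ∘ D.flow t =ᵐ[μ]
      D.flow t ∘ fun (σ : ℤ → ℝ × ℝ) (y : ℤ) => σ (-y) := by
  filter_upwards [hμ] with σ hσ
  simp only [comp_apply]
  exact (flow_reflect D hV hcar hσ t).symm

/-! ## §2. The canonical symmetric dynamics of the pinned anharmonic chain -/

/-- `τ_{-x} (τ_x σ) = σ`. [folklore] -/
theorem chainShift_neg_chainShift (x : ℤ) (σ : ChainConfig) : chainShift (-x) (chainShift x σ) = σ := by
  rw [← ShiftAction.apply_add, neg_add_cancel, ShiftAction.apply_zero]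

/-- **The canonical symmetric Buttà–Marchioro dynamics of `pinnedChain ω₂ lam β γ`**
(`ω₂ ≥ 0`, `lam, β > 0`): ONE infinite-volume dynamics `D` with carrier `𝒳₀ = bmGood`, measurable
flow maps, the identity off `𝒳₀`, the group law on `𝒳₀`, preserving EVERY DLR Gibbs state with the
superstability estimate (2.3) at every temperature (`OscillatorChain.exists_bmDynamics`), and — the
additions of this file — commuting EXACTLY (everywhere, not only a.e.) with the lattice translations
`τ_x`, with the momentum reversal `R` up to time reversal (`R ∘ φ_t = φ_{-t} ∘ R`), and with the
spatial reflection `ι σ = σ(−·)` (`ι ∘ φ_t = φ_t ∘ ι`): on `𝒳₀` by uniqueness of solutions within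
`𝒳₀` and the `τ`/`R`/`ι`-invariance of `𝒳₀`, off `𝒳₀` because the flow is the identity there.
[cite: ButtaMarchioro2016, §2 Thm 2.1 and eq. (2.6)] -/
theorem exists_symmetric_bmDynamics : ∀ (ω₂ lam β γ : ℝ), 0 ≤ ω₂ → 0 < lam → 0 < β → ∃ D : Literature.MathematicalPhysics.KineticTheory.HeatConduction.InfiniteChainDynamics (Literature.MathematicalPhysics.KineticTheory.HeatConduction.pinnedChain ω₂ lam β γ), D.carrier = (Literature.MathematicalPhysics.KineticTheory.HeatConduction.pinnedChain ω₂ lam β γ).bmGood ∧ (∀ t : ℝ, Measurable (D.flow t)) ∧ (∀ (t : ℝ) (σ : ℤ → ℝ × ℝ), σ ∉ (Literature.MathematicalPhysics.KineticTheory.HeatConduction.pinnedChain ω₂ lam β γ).bmGood → D.flow t σ = σ) ∧ (∀ (t s : ℝ) (σ : ℤ → ℝ × ℝ), σ ∈ (Literature.MathematicalPhysics.KineticTheory.HeatConduction.pinnedChain ω₂ lam β γ).bmGood → D.flow (t + s) σ = D.flow t (D.flow s σ)) ∧ (∀ (T : ℝ) (μ : MeasureTheory.Measure (ℤ → ℝ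 × ℝ)), (Literature.MathematicalPhysics.KineticTheory.HeatConduction.pinnedChain ω₂ lam β γ).IsChainGibbsMeasure T μ → (Literature.MathematicalPhysics.KineticTheory.HeatConduction.pinnedChain ω₂ lam β γ).HasSuperstabilityEstimate μ → D.PreservesMeasure μ) ∧ (∀ (t : ℝ) (x : ℤ), D.flow t ∘ Literature.MathematicalPhysics.KineticTheory.HeatConduction.chainShift x = Literature.MathematicalPhysics.KineticTheory.HeatConduction.chainShift x ∘ D.flow t) ∧ (∀ t : ℝ, Literature.MathematicalPhysics.KineticTheory.HeatConduction.chainReversal ∘ D.flow t = D.flow (-t) ∘ Literature.MathematicalPhysics.KineticTheory.HeatConduction.chainReversal) ∧ (∀ t : ℝ, (fun (σ : ℤ → ℝ × ℝ) (y : ℤ) => σ (-y)) ∘ D.flow t = D.flow t ∘ fun (σ : ℤ → ℝ × ℝ) (y : ℤ) => σ (-y)) := by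
  intro ω₂ lam β γ hω hl hβ
  set P := pinnedChain ω₂ lam β γ with hP
  have hU1 := OscillatorChain.pinnedChain_isEvenPolyOfDegree_U β γ hω hl
  have hV1 := OscillatorChain.pinnedChain_isEvenPolyOfDegree_V ω₂ lam γ hβ
  have hU0 : ∀ r, 0 ≤ P.U r := hU1.choose_spec.2.2
  have hV0 : ∀ r, 0 ≤ P.V r := hV1.choose_spec.2.2
  have hVe : ∀ r, P.V (-r) = P.V r := pinnedChain_V_neg ω₂ lam β γ
  obtain ⟨D, hD, hm, hid, hgrp, -, -, hpres⟩ :=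
    OscillatorChain.exists_bmDynamics (P := P) (s₁ := 2) (s₂ := 2) (by norm_num) (by norm_num) hU1 hV1
  refine ⟨D, hD, hm, hid, hgrp, hpres, fun t x => ?_, fun t => ?_, fun t => ?_⟩
  · -- translations
    funext σ
    simp only [comp_apply]
    by_cases hσ : σ ∈ P.bmGood
    · exact D.flow_chainShift_of_carrier_eq_bmGood hD hU0 hV0 hσ t x
    · have hσ' : chainShift x σ ∉ P.bmGood := fun h => hσ <| by
        simpa only [chainShift_neg_chainShift] using
          (OscillatorChain.chainShift_mem_bmGood hU0 hV0 h (-x)).1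
      rw [hid t σ hσ, hid t _ hσ']
  · -- momentum reversal
    funext σ
    simp only [comp_apply]
    by_cases hσ : σ ∈ P.bmGood
    · have h := D.flow_chainReversal_of_carrier_eq_bmGood hD hσ (-t)
      rw [neg_neg] at h
      exact h.symm
    · have hσ' : chainReversal σ ∉ P.bmGood := fun h => hσ ((P.chainReversal_mem_bmGood_iff σ).1 h)
      rw [hid t σ hσ, hid (-t) _ hσ']
  · -- spatial reflection
    funext σ
    simp only [comp_apply]
    by_cases hσ : σ ∈ P.bmGood
    · have hcar : MapsTo (fun (σ : ℤ → ℝ × ℝ) (y : ℤ) => σ (-y)) D.carrier D.carrier := by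
        rw [hD]; exact mapsTo_reflect_bmGood P
      exact (flow_reflect D hVe hcar (hD ▸ hσ) t).symm
    · have hσ' : (fun y : ℤ => σ (-y)) ∉ P.bmGood := fun h =>
        hσ ((reflect_mem_bmGood_iff P σ).1 h)
      rw [hid t σ hσ, hid t _ hσ']

end Summit.AtomisticToContinuum.FouriersLaw.Theorems.MourreDissolution

end
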